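import Summits.BirchSwinnertonDyer.Rank1Residual.Additive.CycLeadingTermDvd
import Summits.BirchSwinnertonDyer.Rank1Residual.X9.IwasawaLowerBound
import HarnessLib

/-!
# Class N10, the whole potentially-ORDINARY locus (defects `e ∈ {2,3,4,6}`), Λ-level: the
# TAME-BRANCH cyclotomic main conjecture in E-INTRINSIC currency — the analytic object typed by
# interpolation through E's OWN modular symbols (no newform with nebentypus needed), the RATIONAL
# main conjecture as a typed input / `@[conjecture]`, and its `T = 0` reduction to the LOWER half
# (cell `b2b-bsdres`, lane CLASS-CLOSURE, seat cc-typer-2; team n1011 row T-c4 = ROUTE-2 §II.4.5)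

HONEST FRAMING (cell `b2b-bsdres`, run/shared/lean/b2b/bsd-rank1-residual/, verbatim in every
file): the goal of the cell is to DELETE the COMBINATION-SHAPED residual classes of the
Birch–Swinnerton-Dyer formula for ALL analytic-rank `≤ 1` elliptic curves over `ℚ` — "full BSD
formula for every rank `≤ 1` curve in class `C`" assembled STRICTLY from published theorems — so
that the rank-`≤ 1` remainder becomes exactly the CONSTRUCTION-SHAPED classes, which are TYPED
(missing-input `Prop`s), NOT attempted. This is not "finishing BSD". Lane CLASS-CLOSURE
(coordinator ruling 2026-08-21T04:07Z): research routes, no claim beyond the stated classes;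
census output = EVIDENCE / conjecture items with held-out validation, NEVER a Literature fact;
the class N10 stays CONSTRUCTION-shaped (RESIDUAL-MAP §I); NOTHING is booked. Four definitions (the
intrinsic Gauss sum, an interpolation predicate, the tame defect, a typed input), ONE `@[conjecture]`
(the universal closure of the typed input — OUR conjecture, NOT in print), and bookkeeping theorems; no named fact is minted; every published input
of every consequence is an explicit named-fact binder of the tree (referee-1 rule R1).

## What and why (ROUTE-2 §II.1 / §II.4.5, row T-c4; HOME/class-closure/typer-2/T-c4-ANSWER.md)

On N10's corner cell (G-ord, `e ∈ {3,4,6}`) — Kodaira `IV/IV*`, `III/III*`, `II/II*` at `p ≥ 5`,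
`e ∣ p − 1` — there is no twist CURVE over `ℚ`: the untwisted object is Delbourgo's newform
`g = f_E ⊗ ε̄ ∈ S₂(Γ₁((N/p²)·p), ε̄²)`, `p`-new, with NEBENTYPUS of conductor `p`, `𝔭`-ordinary
(Compositio 113 (1998) §1.5 "`p ∣ Ñ` iff `d = 3,4,6`"), where `ε` is the Dirichlet character mod `p`
of exact order `e` through which inertia acts on the étale quotient of `V_pE` (`ρ_E|_{I_p} ≅ ε ⊕ ε⁻¹`),
and the Iwasawa theory of `E` over `ℚ_∞` IS the `ε̄`-BRANCH of the Iwasawa theory of `g` over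
`ℚ(μ_{p^∞})` (`E = g ⊗ ε`; ROUTE-2 §II.1; VERBATIM PRINT Delbourgo 1998 p. 132, proof of Thm. 1: "`μ_E(x) := ε^{−1}(x)·μ(f̃, α_p)(x)`",
`f = f̃ ⊗ ε`, our `g` = his `f̃` — page-read n1011-lit GEN 3, HOME/cells/n1011/LIT-INPUTS-P3.md §19.2–19.3, constant below re-derived there). The tree has newforms with nebentypus (`IsNewform1`,
`nebentypus`, the PROVED `exists_isNewform1_twist`) but NO `p`-adic `L`-function for them: the
Mazur–Tate–Teitelbaum apparatus `ratPlusSymbol` / `msdMeasure` / `padicLFunction[Branch]` is typed for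
`CuspForm (Gamma0 N) 2` with `ℚ`-rational symbols. THIS FILE SHOWS THE OBJECT IS NOT NEEDED: by the
inverse-twist identity `g − a_p(g)·g|V_p = f_E ⊗ ε̄ = τ(ε)⁻¹ ∑_{u mod p} ε(u) f_E(z + u/p)`
(`a_{pn}(g) = a_p(g) a_n(g)` for the `p`-new `g`; Shimura Prop. 3.64 / Atkin–Li twisting operator) and
`U_p f_E = a_p(E) f_E = 0` (ADDITIVE reduction), the `ε̄`-branch of the MTT measure of `g` is a
function of E's OWN modular symbols: for `κ` a primitive character of `Γ` of conductor `p^m ≥ p²`,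
`α^{−m} ∑_{b mod p^m} (ε̄κ)(b){∞→b/p^m}_g = α^{−m}·p^{−1}·τ(ε̄)·τ(ε,ψ_κ)·∑_{b mod p^m} κ(b){∞→b/p^m}_{f_E}`
with the INTRINSIC Gauss sum `τ(ε,ψ_κ) = ∑_{t mod p} ε(t) κ(1 + t p^{m−1})` (`t ↦ κ(1 + t p^{m−1})` is
a non-trivial additive character of `ℤ/p` exactly because `cond κ = p^m`, `m ≥ 2`), and at `κ = 1`
`α^{−1} ∑_{b mod p} ε̄(b){∞→b/p}_g = α^{−1}·τ(ε̄)·{∞→0}_{f_E}` (Jacobi-sum collapse; the sum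
`∑_{b mod p}{∞→b/p}_{f_E}` is the symbol of `U_p f_E = 0`). Dividing by `g`'s canonical period
`Ω^{sgn ε}_g`: `L_p(g, α, ε̄, T) = ϖ · B_E(T)` with ONE comparison scalar
`ϖ = τ(ε̄)·Ω⁺_{f_E}/Ω^{sgn ε}_g ∈ K_g ↪ ℚ_p` (INTEGER valuation: the Gauss sum is absorbed into the
period ratio exactly as `√p*` is absorbed by Pal's theorem on defect 2) and an **E-NORMALISED tame
branch `B_E ∈ ℚ_p⟦T⟧`** characterised by interpolation of E's own `Ω⁺_{f_E}`-normalised twisted symbol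
sums (`ratTwistedSymbolSum f_E κ`, `ratPlusSymbol f_E 0`): `B_E(0) = α⁻¹·[0]⁺_{f_E}`,
`B_E(κ(γ)−1) = α^{−m}·p^{−1}·τ(ε,ψ_κ)·∑_b κ(b)[b/p^m]⁺_{f_E}` — the predicate `IsTameBranchOf` (§1),
the literal analogue of the tree's `IsPAdicLFunctionOf f p α L` (MTT (14.3)). `v_𝔭(ϖ)` is EXACTLY the
census quantity of experiment X4-3 (W1: "δ w.r.t. the Néron period"; census-ctyper1
X43-TYPING-PREP; one statement, one owner — not typed here). The same predicate describes defect 2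
(ε = the Legendre symbol mod p, `g` = the `p`-stabilised newform of `E♭`, `ϖ` = Pal's `√p*`-ratio)
and the (M) locus (`α = a_p(E♭) = ±1`), so §2 is ONE statement on the whole N10 locus.

* §1 `tameGaussSum ε κ` (the intrinsic Gauss sum) and `IsTameBranchOf f p ε α B` (E-normalised
  interpolation package; `B` bounded); `tameDefect W p` (`2` on (M), `semistabilityIndex` on (G)).
* §2 `TameBranchRatCharEqAt W p` — the tame-branch cyclotomic main conjecture for `E` at the
  additive potentially-ordinary `p` as a RATIONAL equality, TYPED (the shape of n1011-p06's
  `ChiBranchRatCharEqAt`, T-N10R, and of the tree fact `burungale_castella_skinner_charIdeal_eq_padicLFunction`: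
  `X(E/ℚ_∞)` torsion, `char_Λ X(E/ℚ_∞) = (g)`, `ι g = p^k · B` for some `k ∈ ℤ`), on E's OWN
  cyclotomic line (`W.SelmerDualData κ γ` — the `ε̄`-eigencomponent of `X(g/ℚ(μ_{p^∞}))`); and its
  universal closure `@[conjecture] TameBranchRatCharEq`. WHY RATIONAL: in E-normalisation an
  INTEGRAL divisibility `B_E ∣ c` would hide the period comparison `v(ϖ)` (census X4-3, NOT in print
  off defect 2) inside the normalisation; the rational equality is insensitive to it, and integrality
  re-enters separately and honestly as (i) a finite UNIT-COEFFICIENT certificate on `B_E` (`μ = 0` in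
  E-normalisation — computable from E's symbols: cc-eng-3's ENG-D v0 tabulates exactly the sums
  `x^±_{f_E}` at `a/pⁿ`, `n ≥ 2`) forcing `k ≥ 0` (`X9.exponent_nonneg_of_exists_norm_coeff_eq_one`),
  and (ii) the `T = 0` Manin/lattice binder `α⁻¹·[0]⁺_{f_E} ∈ (L(E,1)/Ω_E)·ℤ_p` (§3).
* §3 `T = 0`: (§2) + (i) + (ii) ⟹ n1011-p18's `CycLeadingTermDvdAt W p` ⟹ (with `ExactLeadingTermAt`,
  Delbourgo 1998 Prop. 4 read as an equality — a theorem on (M), `exactLeadingTermAt_of_potMult`)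
  `Typed.MissingLowerBoundAt W p`: row T-c4's "typed reduction `BranchLowerDivisibility g_E a →
  MissingLowerBoundAt W p`" with `g_E` ELIMINATED. Class forms on X4♯(G-ord) / X3♯(G-ord) (every
  defect) and on the (M) locus.

ROBUSTNESS (docstring of §2): `B` is asked BOUNDED, so it is determined by its values at the
`κ(γ) − 1`; for the conjugate character `ε̄` or a wrong unit `α` the prescribed values differ from
`B_E`'s by `p`-adic units at every `κ`, so a bounded witness, IF any, is `u·B_E` with `u ∈ Λ^×`
(bounded and of absolute value `1` at all `ζ_{p^m} − 1` ⟹ `μ = λ = 0`) and §2's conclusion is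
unchanged; for a non-unit `α` (the slope-one conjugate form) no bounded witness exists (vacuous rows,
not false rows). VACUITY PASS (ROUTE-2 §II.4.4): the premise IS inhabited for the true tuple by
Mazur–Tate–Teitelbaum §I.10–I.14 for `g ∈ S₂(Γ₁(Mp), ε̄²)` (`p`-new, `𝔭`-ordinary, WITH character)
plus the identity above — in print in pieces (MTT 1986 §I; Delbourgo 1998 §1.5–1.6, Thm. 1), NOT a
tree fact and NOT minted here (D-0026; lane: Literature cited-only): the named prerequisite of every
consumer of §3, which therefore takes the tuple `(f, ε, α, B)` with `IsTameBranchOf` as binders; UPDATE (n1011 row T-TB-BRIDGE):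
on the census locus X4-3 (`p ≥ 5`, (G-ord), `e ∈ {3,4,6}`) the tuple is DELIVERED by the typed census input `CensusX43.OrdinaryTwistPartnerAt W p`
— kernel theorem `exists_isTameBranchOf_of_ordinaryTwistPartnerAt` (`TameBranchTeichmuller.lean`; pure `p`-adic analysis, 0 facts).
LITERATURE STATE of §2 (as `GordCycLeadingTerm.lean` "located gap", `GordRatMainConjLowerBound.lean`):
Kato divisibility RATIONALLY = the `ω^i`-form attributed to Kato by Emerton–Pollack–Weston 2006
Thm. 5.1.2 (Hida-family members, `ρ̄` irreducible; the `p`-new `g` is one); Eisenstein divisibility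
on a NON-TRIVIAL tame branch: no printed source (Skinner–Urban 2014 Thm. 3.6.4: trivial character,
`p ∤ N`; Wan 2015: `p` unramified). Fouquet–Wan arXiv:2107.13726 Thm. 1.7 (PREPRINT) announces Kato's
IMC 12.10 EQUALITY for `f_E` at any additive `p` under (Irr) ∧ (Lgl) ∧ (Stb); its (Lgl)
"`ρ̄|_{G_{ℚ_p}}^{ss} ≠ χ̄ ⊕ χ̄ω`" FAILS identically on (M) and at `p = 3`, fails on (G-ord, `e = 2`,
`p ≥ 5`) iff `a_p(E♭) ≡ ±1 (mod p)`, and holds on `e ∈ {3,4,6}` except possibly at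
`(p,e) ∈ {(5,4),(7,3),(7,6)}` (rmap-2 g8: D-i 1 759/3 179, D-ii 1 833/3 710, (M) 0); that sub-class
is typed by name in cc-typer-5's `Additive/FouquetWanLocus.lean`; nothing here depends on it.

References: ROUTE-2.md §II (HOME/cells/n1011/); Delbourgo, Compositio Math. 113 (1998) §1.5–1.6,
Thm. 1, Prop. 4, Main Conjecture p. 151 [Delbourgo1998]; Mazur–Tate–Teitelbaum, Invent. Math. 84
(1986) §I.8–I.14 [MazurTateTeitelbaum1986Invent]; Shimura 1971 Prop. 3.64 [Shimura1971];
Emerton–Pollack–Weston, Invent. Math. 163 (2006) Thm. 5.1.2 [EmertonPollackWeston2006]; Skinner–Urban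
2014 Thm. 3.6.4 [SkinnerUrban2014]; Burungale–Castella–Skinner, IMRN 2025 Thm. 1.1.2 (a) [BurungaleCastellaSkinner2025]; Fouquet–Wan arXiv:2107.13726 (announced); Miller 2011 Def. 1.1 [Miller2011LMS].
-/

noncomputable section

open scoped Classical MatrixGroups ModularForm NumberField

open CongruenceSubgroup WeierstrassCurve NumberField Literature.NumberTheory.EllipticCurves
  Literature.NumberTheory.EllipticCurves.ModularForms
  Literature.NumberTheory.EllipticCurves.Rank1Residual
  Literature.NumberTheory.EllipticCurves.Rank1Residual.Typed
  IsDedekindDomain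

namespace Summit.BirchSwinnertonDyer.Rank1Residual.Additive

/-! ### §1 The E-normalised tame branch, typed by interpolation (E's own symbols) -/

section Interpolation

variable {N : ℕ} (f : CuspForm (Gamma0 N) 2) (p : ℕ) [Fact p.Prime]

/-- **The intrinsic Gauss sum `τ(ε, ψ_κ) = ∑_{t mod p} ε(t) · κ(1 + t·p^{m−1})`** of a character `ε`
mod `p` against the additive character `t ↦ κ(1 + t p^{m−1})` of `ℤ/p` cut out by a Dirichlet
character `κ` mod `p^m` (non-trivial iff `cond κ = p^m`, `m ≥ 2`). No reference root of unity is
chosen: this is the constant produced by the inverse-twist identity of the module docstring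
(Mazur–Tate–Teitelbaum 1986 §I.8 for the Gauss sums; the identity itself is this seat's bookkeeping,
HOME/class-closure/typer-2/T-c4-ANSWER.md §2). Against a FIXED primitive `ψ` on `ℤ/p`: `ψ_κ = ψ(c_κ ·)`, `c_κ` a unit, and
`τ(ε, ψ_κ) = ε̄(c_κ)·τ(ε, ψ)` (`exists_apply_mul_tameGaussSum_eq`, `TameBranchGaussShift.lean`), so `p^{−1}τ(ε̄,ψ)τ(ε,ψ_κ) = ε(−1)ε̄(c_κ)`
is a ROOT OF UNITY and `‖τ(ε, ψ_κ)‖` is the same for every `κ` (`norm_tameGaussSum_eq`). Nothing asserted. [cite: MazurTateTeitelbaum1986Invent,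
§I.8 (shape; primary NOT page-checked on this hub — scanned copy, flag `MTT86-primary-unreadable-on-hub`)] -/
def tameGaussSum (ε : DirichletCharacter ℂ_[p] p) {m : ℕ} (κ : DirichletCharacter ℂ_[p] (p ^ m)) :
    ℂ_[p] :=
  ∑ t : ZMod p, ε t * κ (1 + ((t.val : ℕ) : ZMod (p ^ m)) * ((p : ZMod (p ^ m)) ^ (m - 1)))

/-- **`IsTameBranchOf f p ε α B`: `B ∈ ℚ_p⟦T⟧` is the E-NORMALISED `ε̄`-branch** — the interpolation
package, in E's OWN `Ω⁺_f`-normalised modular symbols, of `ϖ⁻¹ · L_p(g, α, ε̄, T)` for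
`g = f ⊗ ε̄` (module docstring; `f` = the newform of the additive curve, `ε` the order-`e` inertia
character, `α` the unit `U_p`-eigenvalue of `g`, `γ = cyclotomicGenerator p`, `T ↔ γ − 1`):
* `B` is BOUNDED (a measure, not a distribution: `B ∈ Λ[1/p]`);
* `B(0) = α⁻¹ · [0]⁺_f` (the Jacobi-sum collapse at the tame character itself, using `U_p f = 0`);
* for every `m ≥ 2` and every primitive Dirichlet character `κ` of conductor `p^m` with values in
  `ℂ_p` which is a character of `Γ` (even, of `p`-power order):
  `B(κ(γ) − 1) = α^{−m} · p^{−1} · τ(ε, ψ_κ) · ∑_{a mod p^m} κ(a)[a/p^m]⁺_f` (`ratTwistedSymbolSum f κ`).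
The literal analogue of the tree's `IsPAdicLFunctionOf f p α L` (MTT §I.14 (14.3)) for the tame branch
at an ADDITIVE potentially-ordinary prime; a predicate — nothing asserted, no existence claimed
(existence for the true `(ε, α)` = MTT §I.10–I.14 for `S₂(Γ₁(Mp), ε̄²)` + the inverse-twist identity,
the named prerequisite of the module docstring; NOT a tree fact).
[cite: MazurTateTeitelbaum1986Invent, §I.10–I.14, (14.3) (shape only; nothing asserted; primary not page-checked on this hub, flag `MTT86-primary-unreadable-on-hub`)]
[cite: Delbourgo1998, §1.5–1.6, Thm. 1 and p. 132 `μ_E := ε^{−1}·μ(f̃, α_p)` (shape only)] -/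
def IsTameBranchOf (ε : DirichletCharacter ℂ_[p] p) (α : ℚ_[p]) (B : PowerSeries ℚ_[p]) : Prop :=
  (∃ C : ℝ, ∀ n : ℕ, ‖PowerSeries.coeff n B‖ ≤ C) ∧
    PowerSeries.constantCoeff B = α⁻¹ * (ratPlusSymbol f 0 : ℚ_[p]) ∧
    ∀ (m : ℕ), 2 ≤ m → ∀ κ : DirichletCharacter ℂ_[p] (p ^ m), κ.IsPrimitive → κ.Even →
      (∃ j : ℕ, orderOf κ = p ^ j) →
        HasSum (fun k : ℕ ↦ algebraMap ℚ_[p] ℂ_[p] (PowerSeries.coeff k B) *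
            (κ (cyclotomicGenerator p : ZMod (p ^ m)) - 1) ^ k)
          (algebraMap ℚ_[p] ℂ_[p] (α⁻¹ ^ m * (p : ℚ_[p])⁻¹) * tameGaussSum p ε κ *
            ratTwistedSymbolSum f κ)

/-- The `T = 0` row of the package: `B(0) = α⁻¹ · [0]⁺_f`. [folklore] -/
theorem IsTameBranchOf.constantCoeff {ε : DirichletCharacter ℂ_[p] p} {α : ℚ_[p]}
    {B : PowerSeries ℚ_[p]} (h : IsTameBranchOf f p ε α B) :
    PowerSeries.constantCoeff B = α⁻¹ * (ratPlusSymbol f 0 : ℚ_[p]) :=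
  h.2.1

/-- The boundedness row of the package (`B` is a measure). [folklore] -/
theorem IsTameBranchOf.bounded {ε : DirichletCharacter ℂ_[p] p} {α : ℚ_[p]}
    {B : PowerSeries ℚ_[p]} (h : IsTameBranchOf f p ε α B) :
    ∃ C : ℝ, ∀ n : ℕ, ‖PowerSeries.coeff n B‖ ≤ C :=
  h.1

end Interpolation

section Defect

variable (W : WeierstrassCurve ℚ) [W.IsElliptic] [W.IsGloballyMinimal] (p : ℕ)

/-- **The tame defect `e(E,p)`** — the order of the character through which inertia at `p` acts on
the étale quotient of `V_pE` at an additive, potentially ORDINARY prime: `2` on the (M) locus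
(Kodaira `I_n^*`: `E` is the `χ_{p*}`-twist of a Tate curve), and Delbourgo's
`d = 12 / gcd(12, v_p Δ_min) ∈ {2,3,4,6}` (the tree's `semistabilityIndex W p`, Kodaira `I₀* ↦ 2`,
`IV/IV* ↦ 3`, `III/III* ↦ 4`, `II/II* ↦ 6`) on the potentially good locus — `semistabilityIndex` alone
is junk on (M) (`SharpenedStatements`, docstring of `semistabilityIndex`). The order of the Dirichlet
character `ε` of §2. [cite: Delbourgo1998, §1.5 (d ∈ {2,3,4,6}) and hypothesis (M) (p. 133)] -/
def tameDefect : ℕ := if PotMult W p then 2 else semistabilityIndex W p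

/-- On the (M) locus the tame defect is `2`. [folklore] -/
@[simp] theorem tameDefect_of_potMult (h : PotMult W p) : tameDefect W p = 2 := by
  simp [tameDefect, h]

/-- Off the (M) locus the tame defect is the semistability index `12 / gcd(12, v_p Δ_min)`. [folklore] -/
@[simp] theorem tameDefect_of_not_potMult (h : ¬ PotMult W p) :
    tameDefect W p = semistabilityIndex W p := by
  simp [tameDefect, h]

end Defect

/-! ### §2 The typed input: the tame-branch main conjecture for `E` at an additive potentially
ordinary prime, RATIONAL form, E-intrinsic -/

/-- **The tame-branch cyclotomic main conjecture at an additive potentially-ORDINARY prime, as a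
RATIONAL equality, TYPED (E-intrinsic).** For the globally minimal additive curve `E = W` and the odd
prime `p` of additive reduction at which `E` is potentially multiplicative (`ord_p j < 0`) or
potentially good ordinary of type (G) (`TypeGOrd W p`) — the N10 locus, tame defect
`e = tameDefect W p ∈ {2,3,4,6}` (`2` on (M), `semistabilityIndex W p` on (G)), `e ∣ p − 1`: whenever
`f` is the newform of `W`, `ε` is a Dirichlet character mod `p` of exact order `e` (values in `ℂ_p`), `α ∈ ℚ_p` is a unit, `B` satisfies
the E-normalised tame-branch interpolation package `IsTameBranchOf f p ε α B` (§1), and `κ`/`γ` is the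
cyclotomic `ℤ_p`-extension of `ℚ` with a topological generator matching the cyclotomic variable, then
for every Pontryagin-dual datum `D` of `Sel_{p^∞}(W/ℚ_∞)`: `X(W/ℚ_∞)` is `Λ`-torsion and
`char_Λ X(W/ℚ_∞) = (g)` with `ι g = p^k · B` for some `k ∈ ℤ` (`ι : Λ ↪ ℚ_p⟦T⟧`). Dictionary (module
docstring): `X(W/ℚ_∞)` = the `ε̄`-eigencomponent of `X(g/ℚ(μ_{p^∞}))` and `B = ϖ⁻¹ L_p(g, α, ε̄, T)`
for `g = f ⊗ ε̄`, so this is the `ε̄`-branch main conjecture of the `p`-new `𝔭`-ordinary newform `g`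
WITH nebentypus `ε̄²` (trivial iff `e = 2`) "in `Λ ⊗ ℚ_p`" — the conclusion SHAPE of
`burungale_castella_skinner_charIdeal_eq_padicLFunction` (BCS 2025 Thm. 1.1.2 (a)) and of
`ChiBranchRatCharEqAt` (defect 2, `p ≡ 1 (mod 4)`). ROBUSTNESS: among the `φ(e) ≤ 2` characters of
order `e` and the units `α` only the true pair (`ε = ` inertia character of the étale quotient,
`α = ` its Frobenius value) admits a bounded `B`, up to `Λ^×` (module docstring) — wrong choices give
vacuous rows. OPEN on every cell — a predicate on `(W, p)`; its universal closure
`TameBranchRatCharEq` is OUR CONJECTURE, not in print (Kato half rationally: EPW 2006 Thm. 5.1.2's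
attribution; Eisenstein half on a non-trivial tame branch: no printed source; SU 2014 Thm. 3.6.4 =
trivial branch, `p ∤ N`). [cite: BurungaleCastellaSkinner2025, Thm. 1.1.2 (a) (shape only; nothing asserted)]
[cite: EmertonPollackWeston2006, Thm. 5.1.2 (the rational `ω^i`-divisibility attributed to Kato; shape)]
[cite: Delbourgo1998, Main Conjecture (p. 151) (shape only; nothing asserted)] -/
def TameBranchRatCharEqAt (W : WeierstrassCurve ℚ) [W.IsElliptic] [W.IsGloballyMinimal] (p : ℕ)
    [Fact p.Prime] : Prop :=
  ∀ {κ : ZpExtension ℚ p} {γ : Field.absoluteGaloisGroup ℚ} {N : ℕ} [NeZero N]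
    {f : CuspForm (Gamma0 N) 2} (ε : DirichletCharacter ℂ_[p] p) (α : ℚ_[p]) (B : PowerSeries ℚ_[p]),
    p ≠ 2 → Addv W p → (PotMult W p ∨ TypeGOrd W p) →
    κ.IsCyclotomic → κ.IsTopGenerator γ → IsCyclotomicVariable p γ → IsNewformOf W f →
    orderOf ε = tameDefect W p → ‖α‖ = 1 → IsTameBranchOf f p ε α B →
    ∀ D : W.SelmerDualData κ γ,
      D.IsTorsion ∧
      ∃ (g : IwasawaAlgebra p) (k : ℤ), D.charIdeal = Ideal.span {g} ∧
        iwasawaToPowerSeries p g = PowerSeries.C ((p : ℚ_[p]) ^ k) * B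

/-- **OUR CONJECTURE (typed; NOT in print; nothing asserted): the tame-branch main conjecture, rational
form, at EVERY additive potentially-ordinary prime of EVERY elliptic curve over `ℚ`** — the universal
closure of `TameBranchRatCharEqAt`. It is the Λ-level statement above N10's two `T = 0` residuals
(`CycLeadingTermAt`, Kato direction; `CycLeadingTermDvdAt` / `CycLowerLeadingTermAt`, main-conjecture
direction) on the WHOLE N10 locus, uniformly in the defect `e ∈ {2,3,4,6}`: "the tame-branch IMC for
ONE `p`-ordinary newform (with nebentypus iff `e ∤ 2`)". Expected also on the reducible (X3) rows (a
RATIONAL equality is insensitive to `μ` and to the lattice; cf. Greenberg–Vatsal 2000 for good ordinary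
`p`). EVIDENCE label (lane CLASS-CLOSURE; census = evidence, never a Literature fact): for the Λ-adic EQUALITY — none (no instrument
reaches it); for the interpolation DATA of §1 (validation, not evidence for the MC; HOME/class-closure/instruments/B-8.md §9–9b, N10/README
2026-08-21T07:43Z): cc-eng-3's ENG-D tables of E's symbol sums at levels `p², p³` on the 4 495 (G-ord) typeG cells are TWO-ENGINE (`0` mismatches
in `2 × 2 086 840` entries) and engine 2's solved `U_p`-eigenvalue of `f_E ⊗ χ̄` = the Frobenius datum `ã_p(χ)` on `4 495/4 495` cells; the `T = 0` consequences inherit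
N10's census (`N10LowerHalfStatements`: LOWER content rows, 49 validated `p = 3` rows). An OPEN PROBLEM stated as a `Prop`; nothing asserted.
[cite: Delbourgo1998, Main Conjecture (p. 151) (shape only; nothing asserted)]
[cite: EmertonPollackWeston2006, Thm. 5.1.2 (Kato half, rational, attributed; shape)] -/
@[conjecture] def TameBranchRatCharEq : Prop :=
  ∀ (W : WeierstrassCurve ℚ) [W.IsElliptic] [W.IsGloballyMinimal] (p : ℕ) [Fact p.Prime],
    TameBranchRatCharEqAt W p

/-! ### §3 `T = 0`: the rational main conjecture + a unit coefficient + the period binder ⟹ the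
LOWER-half input `CycLeadingTermDvdAt`, hence `MissingLowerBoundAt` -/

section TZero

variable (W : WeierstrassCurve ℚ) [W.IsElliptic] [W.IsGloballyMinimal] (p : ℕ) [hp : Fact p.Prime]

/-- **`T = 0` shadow of the rational tame-branch main conjecture.** Under `TameBranchRatCharEqAt W p`,
for a tame-branch tuple `(f, ε, α, B)` of `W` at `p` (binders as in §2) and any cyclotomic datum: every
`c ∈ char_Λ X(W/ℚ_∞)` has constant term `c(0) = a · p^k · α⁻¹ · [0]⁺_f` in `ℚ_p` with `a ∈ ℤ_p` and
`k ∈ ℤ` the exponent of the conjecture (`[0]⁺_f = L(f,1)/Ω⁺_f`; MTT §I.14 at the tame character: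
`B(0) = α⁻¹[0]⁺_f` is the `κ = 1` row of `IsTameBranchOf`). Pure bookkeeping.
[cite: MazurTateTeitelbaum1986Invent, §I.13–I.14 (constant term; shape)] -/
theorem constantCoeff_of_tameBranchRatCharEq (hT : TameBranchRatCharEqAt W p)
    {κ : ZpExtension ℚ p} {γ : Field.absoluteGaloisGroup ℚ} {N : ℕ} [NeZero N]
    {f : CuspForm (Gamma0 N) 2} {ε : DirichletCharacter ℂ_[p] p} {α : ℚ_[p]}
    {B : PowerSeries ℚ_[p]}
    (hp2 : p ≠ 2) (hadd : Addv W p) (hloc : PotMult W p ∨ TypeGOrd W p)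
    (hκ : κ.IsCyclotomic) (hγ : κ.IsTopGenerator γ) (hcv : IsCyclotomicVariable p γ)
    (hf : IsNewformOf W f) (hε : orderOf ε = tameDefect W p) (hα : ‖α‖ = 1)
    (hB : IsTameBranchOf f p ε α B) (D : W.SelmerDualData κ γ) {c : IwasawaAlgebra p}
    (hc : c ∈ D.charIdeal) :
    ∃ (a : ℤ_[p]) (k : ℤ), ((PowerSeries.constantCoeff c : ℤ_[p]) : ℚ_[p]) =
      (a : ℚ_[p]) * (p : ℚ_[p]) ^ k * (α⁻¹ * (ratPlusSymbol f 0 : ℚ_[p])) := by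
  obtain ⟨-, g, k, hspan, hιg⟩ := hT ε α B hp2 hadd hloc hκ hγ hcv hf hε hα hB D
  rw [hspan] at hc
  obtain ⟨a, rfl⟩ := Ideal.mem_span_singleton'.mp hc
  refine ⟨PowerSeries.constantCoeff a, k, ?_⟩
  have h0 := congrArg PowerSeries.constantCoeff hιg
  rw [constantCoeff_iwasawaToPowerSeries, map_mul, PowerSeries.constantCoeff_C,
    hB.constantCoeff] at h0
  rw [map_mul, PadicInt.coe_mul, h0]
  ring

/-- **The LOWER-half input at `T = 0` from the rational tame-branch main conjecture plus ONE finite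
certificate and the period binder.** For `E = W` globally minimal, `p ≠ 2` additive of type (M) or
(G-ord): `TameBranchRatCharEqAt W p`, a tame-branch tuple `(f, ε, α, B)` with `IsTameBranchOf f p ε α B`
(existence = the named MTT prerequisite of the module docstring), the certificate "SOME coefficient of
the E-normalised branch `B` is a `p`-adic unit" (`hcert`; forces the exponent `k ≥ 0`,
`X9.exponent_nonneg_of_exists_norm_coeff_eq_one`), and the `T = 0` period binder `h0`:
`α⁻¹ · [0]⁺_f = z₀ · q` with `z₀ ∈ ℤ_p` and `L(E,1) = q · Ω_E` (i.e. `ord_p (L(f,1)/Ω⁺_f) ≥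
ord_p (L(E,1)/Ω_E)`: the Manin-constant / period-lattice comparison of the additive curve with its
newform in the LOWER direction — a binder, discharged elsewhere where the tree has it) ⟹ n1011-p18's
`CycLeadingTermDvdAt W p` ("`L(E,1)/Ω_E ∣ c(0)` for every `c ∈ char X(E/ℚ_∞)`").
[cite: Delbourgo1998, Main Conjecture (p. 151) (shape; main-conjecture direction at `T = 0`)]
[cite: MazurTateTeitelbaum1986Invent, §I.13–I.14 (constant term; shape)] -/
theorem cycLeadingTermDvdAt_of_tameBranchRatCharEq_of_unitCoeff (hT : TameBranchRatCharEqAt W p)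
    {N : ℕ} [NeZero N] {f : CuspForm (Gamma0 N) 2} {ε : DirichletCharacter ℂ_[p] p} {α : ℚ_[p]}
    {B : PowerSeries ℚ_[p]}
    (hp2 : p ≠ 2) (hadd : Addv W p) (hloc : PotMult W p ∨ TypeGOrd W p)
    (hf : IsNewformOf W f) (hε : orderOf ε = tameDefect W p) (hα : ‖α‖ = 1)
    (hB : IsTameBranchOf f p ε α B) (hcert : ∃ n : ℕ, ‖PowerSeries.coeff n B‖ = 1)
    {q : ℚ} (hq : W.entireLFunction 1 = (q : ℂ) * (W.realPeriodRat : ℂ))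
    {z₀ : ℤ_[p]} (h0 : α⁻¹ * (ratPlusSymbol f 0 : ℚ_[p]) = (z₀ : ℚ_[p]) * (q : ℚ_[p])) :
    CycLeadingTermDvdAt W p := by
  intro κ γ hκ hγ hcv D c hc
  obtain ⟨-, g, k, hspan, hιg⟩ := hT ε α B hp2 hadd hloc hκ hγ hcv hf hε hα hB D
  have hk : 0 ≤ k := X9.exponent_nonneg_of_exists_norm_coeff_eq_one g B k hιg hcert
  rw [hspan] at hc
  obtain ⟨a, rfl⟩ := Ideal.mem_span_singleton'.mp hc
  have h0g := congrArg PowerSeries.constantCoeff hιg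
  rw [constantCoeff_iwasawaToPowerSeries, map_mul, PowerSeries.constantCoeff_C,
    hB.constantCoeff, h0] at h0g
  obtain ⟨k', hk'⟩ := Int.eq_ofNat_of_zero_le hk
  refine ⟨PowerSeries.constantCoeff a * (p : ℤ_[p]) ^ k' * z₀, q, hq, ?_⟩
  rw [map_mul, PadicInt.coe_mul, h0g, hk', zpow_natCast]
  push_cast
  ring

/-- **The LOWER half on the (G)-ordinary cell (X4♯(G-ord), EVERY defect `e ∈ {2,3,4,6}`), analytic
rank `0`, from the rational tame-branch main conjecture:** `TameBranchRatCharEqAt W p` + a tame-branch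
tuple with the unit-coefficient certificate and the period binder (previous theorem) + the exact
algebraic leading term `ExactLeadingTermAt W p` (Delbourgo 1998 Prop. 4 as an equality, typed by
n1011-p18; its `H¹`-factor has `p`-part `1` on (G), `GordCycLeadingTerm.lean` reading note) +
Gross–Zagier–Kolyvagin + modularity ⟹ `Typed.MissingLowerBoundAt W p` (`ord_p #Ш_an ≤ ord_p #Ш`).
This is row T-c4's "typed reduction `BranchLowerDivisibility g_E a → MissingLowerBoundAt W p`" with
`g_E` eliminated. X4♯(G-ord) stays CONSTRUCTION-SHAPED; nothing booked.
[cite: Delbourgo1998, Prop. 4 (p. 144), Main Conjecture (p. 151) (shapes)] [cite: Miller2011LMS, Def. 1.1] -/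
theorem ClassX4Gord.missingLowerBoundAt_rankZero_of_tameBranchRatCharEq_of_unitCoeff
    (hGZK : rank_eq_analyticRank_of_analyticRank_le_one) (hmod : hasEntireLFunction_rat)
    (hT : TameBranchRatCharEqAt W p)
    {N : ℕ} [NeZero N] {f : CuspForm (Gamma0 N) 2} {ε : DirichletCharacter ℂ_[p] p} {α : ℚ_[p]}
    {B : PowerSeries ℚ_[p]}
    (hX : ClassX4Gord W p) (hr : W.analyticRank = 0)
    (hf : IsNewformOf W f) (hε : orderOf ε = tameDefect W p) (hα : ‖α‖ = 1)
    (hB : IsTameBranchOf f p ε α B) (hcert : ∃ n : ℕ, ‖PowerSeries.coeff n B‖ = 1)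
    {q : ℚ} (hq : W.entireLFunction 1 = (q : ℂ) * (W.realPeriodRat : ℂ))
    {z₀ : ℤ_[p]} (h0 : α⁻¹ * (ratPlusSymbol f 0 : ℚ_[p]) = (z₀ : ℚ_[p]) * (q : ℚ_[p]))
    (hEx : ExactLeadingTermAt W p) : MissingLowerBoundAt W p :=
  ClassX4Gord.missingLowerBoundAt_rankZero_of_cycLeadingTermDvd_of_exact hGZK hmod hX hr
    (cycLeadingTermDvdAt_of_tameBranchRatCharEq_of_unitCoeff W p hT hX.1.1 hX.1.2.1 (Or.inr hX.2)
      hf hε hα hB hcert hq h0) hEx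

/-- **The LOWER half on X3♯(G-ord) (EVERY defect), analytic rank `0`, from the rational tame-branch
main conjecture** (same inputs; on reducible rows the unit-coefficient certificate and the period
binder are genuinely per-pair data — W1's five `p`-isogeny anomaly rows of experiment X4-3 are X3 rows).
X3♯(G-ord) stays CONSTRUCTION-SHAPED; nothing booked.
[cite: Delbourgo1998, Prop. 4 (p. 144), Main Conjecture (p. 151) (shapes)] [cite: Miller2011LMS, Def. 1.1] -/
theorem ClassX3Gord.missingLowerBoundAt_rankZero_of_tameBranchRatCharEq_of_unitCoeff
    (hGZK : rank_eq_analyticRank_of_analyticRank_le_one) (hmod : hasEntireLFunction_rat)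
    (hT : TameBranchRatCharEqAt W p)
    {N : ℕ} [NeZero N] {f : CuspForm (Gamma0 N) 2} {ε : DirichletCharacter ℂ_[p] p} {α : ℚ_[p]}
    {B : PowerSeries ℚ_[p]}
    (hp2 : p ≠ 2) (hX : ClassX3Gord W p) (hr : W.analyticRank = 0)
    (hf : IsNewformOf W f) (hε : orderOf ε = tameDefect W p) (hα : ‖α‖ = 1)
    (hB : IsTameBranchOf f p ε α B) (hcert : ∃ n : ℕ, ‖PowerSeries.coeff n B‖ = 1)
    {q : ℚ} (hq : W.entireLFunction 1 = (q : ℂ) * (W.realPeriodRat : ℂ))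
    {z₀ : ℤ_[p]} (h0 : α⁻¹ * (ratPlusSymbol f 0 : ℚ_[p]) = (z₀ : ℚ_[p]) * (q : ℚ_[p]))
    (hEx : ExactLeadingTermAt W p) : MissingLowerBoundAt W p :=
  ClassX3Gord.missingLowerBoundAt_rankZero_of_cycLeadingTermDvd_of_exact hGZK hmod hX hr
    (cycLeadingTermDvdAt_of_tameBranchRatCharEq_of_unitCoeff W p hT hp2 hX.1.2 (Or.inr hX.2)
      hf hε hα hB hcert hq h0) hEx

/-- **The LOWER half on the (M) locus, analytic rank `0`, from the rational tame-branch main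
conjecture** (`ε` = the Legendre symbol mod `p`, `α = a_p(E♭) = ±1`, `g` = the newform of the
multiplicative twist `E♭`): here the exact leading term is Delbourgo's THEOREM (Prop. 4 + §2.2
Lemma (ii), named fact `hDelX`, `exactLeadingTermAt_of_potMult`), so the inputs are the conjecture,
the tuple with its certificate, and the period binder only. The (M) cell stays CONSTRUCTION-SHAPED;
nothing booked. [cite: Delbourgo1998, Prop. 4 (p. 144), §2.2 Lemma (ii) (p. 139), Main Conjecture (p. 151)]
[cite: Miller2011LMS, Def. 1.1] -/
theorem missingLowerBoundAt_rankZero_of_potMult_of_tameBranchRatCharEq_of_unitCoeff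
    (hDelX : Delbourgo1998.prop4_rankZero_constantCoeff_eq_unit_mul_of_potMult)
    (hGZK : rank_eq_analyticRank_of_analyticRank_le_one) (hmod : hasEntireLFunction_rat)
    (hT : TameBranchRatCharEqAt W p)
    {N : ℕ} [NeZero N] {f : CuspForm (Gamma0 N) 2} {ε : DirichletCharacter ℂ_[p] p} {α : ℚ_[p]}
    {B : PowerSeries ℚ_[p]}
    (hp2 : p ≠ 2) (hadd : Addv W p) (hj : padicValRat p W.j < 0) (hr : W.analyticRank = 0)
    (hf : IsNewformOf W f) (hε : orderOf ε = tameDefect W p) (hα : ‖α‖ = 1)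
    (hB : IsTameBranchOf f p ε α B) (hcert : ∃ n : ℕ, ‖PowerSeries.coeff n B‖ = 1)
    {q : ℚ} (hq : W.entireLFunction 1 = (q : ℂ) * (W.realPeriodRat : ℂ))
    {z₀ : ℤ_[p]} (h0 : α⁻¹ * (ratPlusSymbol f 0 : ℚ_[p]) = (z₀ : ℚ_[p]) * (q : ℚ_[p])) :
    MissingLowerBoundAt W p :=
  missingLowerBoundAt_rankZero_of_potMult_of_cycLeadingTermDvd W p hDelX hGZK hmod hp2 hadd hj hr
    (cycLeadingTermDvdAt_of_tameBranchRatCharEq_of_unitCoeff W p hT hp2 hadd (Or.inl hj)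
      hf hε hα hB hcert hq h0)

end TZero

end Summit.BirchSwinnertonDyer.Rank1Residual.Additive

end
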